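import Mathlib
import Summits.Schanuel.Schanuel.Theses.RigidCore
import Literature.NumberTheory.Transcendental.LindemannWeierstrassProofs
import Literature.NumberTheory.Transcendental.KernelTranslatesRankTwoSectors
import Literature.NumberTheory.Transcendental.TranscendentalSpecialization
import Literature.RingTheory.MvPolynomial.PlaneCurvesDilationStructure
import Literature.RingTheory.MvPolynomial.PlaneCurvesRationalLine

/-!
# Crux `MinimalCounterexampleInAcl` (S*), line `kernel-arithmetic-selection` — stub 4a:
# branch finiteness at rank 2

For a ℚ-linearly independent pair `x = (x₀, x₁)` with `trdeg ℚ(x, eˣ) < 2`, the set `D` of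
integer vectors `k ∈ ℤ²` such that the kernel translate `x_k := x + 2πi k` is again independent
and `(x_k, e^{x_k}) = (x_k, eˣ)` satisfies every ℚ-polynomial relation of `(x, eˣ)` is FINITE
(`stub_branchFiniteness_rankTwo`, registered stub of the skeleton
`Cruxes/MinimalCounterexampleInAcl/Lines/kernel-arithmetic-selection.lean`). Baker-free; the
only transcendence input is Hermite–Lindemann (`transcendental_exp_holds`).

Proof.
* MOVING SECTOR (`movingSector_finite`, Literature `KernelTranslatesRankTwoSectors`): some
  `e^{x_i}` is transcendental; each coordinate of a mate is a root of a nonzero `p_j(·, e^{x_i})`.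
* LOG SECTOR, `e^{x₀}, e^{x₁}` algebraic: `trdeg < 2` gives an irreducible `F ∈ ℚ[z₀, z₁]` with
  `F(x) = 0`, and `F(x_k) = 0` for `k ∈ D`.
  - `2πi` TRANSCENDENTAL over `ℚ[x₀, x₁]` (`logSector_transcendentalPeriod`): `D ⊆ {0}`.
  - `2πi` ALGEBRAIC over `ℚ[x₀, x₁]` (`logSector_algebraicPeriod_finite`, the geometric case —
    conjecturally empty but excluded by no theorem): `x₀, x₁` are algebraic over `ℚ[2πi]`
    (exchange), so the curve `(x₀, x₁, 2πi)` SPECIALISES at `2πi ↦ 2ʲc`, `j ≤ m`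
    (`exists_specialization`: Chevalley valuation ring + weak Nullstellensatz), giving algebraic
    points with `b_j + 2ʲc·D ⊆ V(F) ⊆ ℚ̄²`; by pigeonhole one irreducible `ℚ̄`-factor `G` of
    `F` (`m` = number of factors) carries two of these families on an infinite `D' ⊆ D`; the
    STRUCTURE LEMMA (`structure_lemma`: weak Bezout, dilation symmetry, homogeneity, cone ⇒
    line) makes `G` a line with rational direction `q`; then `isAlgebraic_of_linear_dvd` makes
    `q·x` algebraic, against Hermite–Lindemann (`not_isAlgebraic_intCombination`).

## References

* [Lindemann1882] F. Lindemann, *Über die Zahl π*, Math. Ann. 20 (1882).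
* [Lang1966] S. Lang, *Introduction to transcendental numbers*, Addison–Wesley 1966, Ch. II §1.
* [Fulton1969] W. Fulton, *Algebraic Curves*, Benjamin 1969, Ch. 1 §6.
-/

noncomputable section

set_option linter.dupNamespace false

open Complex Set
open Literature.RingTheory.MvPolynomial.PlaneCurves
open Literature.NumberTheory.Transcendental.Specialization
open Literature.NumberTheory.Transcendental.KernelTranslatesRankTwo

namespace Summit.Schanuel.Schanuel.Cruxes.MinimalCounterexampleInAcl.KernelArithmeticSelection

/-! ## The log sector with algebraic period: assembly -/

/-- LOG SECTOR, ALGEBRAIC PERIOD — the geometric case. For an irreducible `F ∈ ℚ[z₀, z₁]` through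
the ℚ-independent point `x` with `e^{x₀}, e^{x₁} ∈ ℚ̄` and `2πi` algebraic over `ℚ[x₀, x₁]`, only
finitely many kernel translates `x + 2πik` lie on `V(F)`: `x₀, x₁` are algebraic over `ℚ[2πi]`
(exchange), so `(x₀, x₁, 2πi)` specialises at `2πi ↦ 2ʲc` (`exists_specialization`), giving
`b_j + 2ʲc·D ⊆ V(F) ⊆ ℚ̄²`; by pigeonhole one irreducible `ℚ̄`-factor `G` of `F` carries two of
these families on an infinite `D' ⊆ D`, the structure lemma makes `G` a rational line, and
`isAlgebraic_of_linear_dvd` + Hermite–Lindemann give the contradiction. [cite: Lang1966, Ch. II §1] -/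
theorem logSector_algebraicPeriod_finite (x : Fin 2 → ℂ) (hx : LinearIndependent ℚ x)
    (halg : ∀ i, IsAlgebraic ℚ (cexp (x i))) (F : MvPolynomial (Fin 2) ℚ) (hF : Irreducible F)
    (hFx : MvPolynomial.aeval x F = 0)
    (hT : IsAlgebraic (Algebra.adjoin ℚ (Set.range x)) (2 * ↑Real.pi * I)) :
    {k : Fin 2 → ℤ |
      MvPolynomial.aeval (fun i => x i + 2 * ↑Real.pi * I * (k i : ℂ)) F = 0}.Finite := by
  classical
  by_contra hinf
  set s : ℂ := 2 * ↑Real.pi * I with hs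
  set D := {k : Fin 2 → ℤ | MvPolynomial.aeval (fun i => x i + s * (k i : ℂ)) F = 0} with hD
  -- transcendence of the data (Hermite–Lindemann)
  have hs0 : s ≠ 0 := by simp [hs, Real.pi_ne_zero, Complex.I_ne_zero]
  have hst : Transcendental ℚ s := by
    intro hsalg
    apply Literature.NumberTheory.Transcendental.transcendental_exp_holds hsalg hs0
    rw [hs, Complex.exp_two_pi_mul_I]
    exact isAlgebraic_one
  have hxt : ∀ j, Transcendental ℚ (x j) := fun j hxalg =>
    Literature.NumberTheory.Transcendental.transcendental_exp_holds hxalg (hx.ne_zero j) (halg j)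
  have hF0 : F ≠ 0 := hF.ne_zero
  have halgx := isAlgebraic_adjoin_period hst hxt hF0 hFx hT
  obtain ⟨S, hSfin, hspec⟩ := exists_specialization hst halgx
  -- the field of algebraic numbers
  haveI hAC : IsAlgClosed (algebraicClosure ℚ ℂ) := (algebraicClosure.isAlgClosure ℚ ℂ).isAlgClosed
  haveI hAI : Algebra.IsIntegral ℚ (algebraicClosure ℚ ℂ) :=
    Algebra.isAlgebraic_iff_isIntegral.mp (algebraicClosure.isAlgebraic ℚ ℂ)
  set FA : MvPolynomial (Fin 2) (algebraicClosure ℚ ℂ) :=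
    MvPolynomial.map (algebraMap ℚ (algebraicClosure ℚ ℂ)) F with hFA
  have hFA0 : FA ≠ 0 := by
    intro h
    apply hF0
    apply MvPolynomial.map_injective _ (algebraMap ℚ (algebraicClosure ℚ ℂ)).injective
    rw [← hFA, h, map_zero]
  set fac := UniqueFactorizationMonoid.factors FA with hfac
  set m := Multiset.card fac with hm
  -- a zero of `F` over `ℚ̄` is a zero of one of its irreducible factors
  have hfacprop : ∀ p : Fin 2 → algebraicClosure ℚ ℂ, MvPolynomial.eval p FA = 0 →
      ∃ G ∈ fac, MvPolynomial.eval p G = 0 := by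
    intro p hp
    obtain ⟨u, hu⟩ := UniqueFactorizationMonoid.factors_prod hFA0
    have hprod : MvPolynomial.eval p fac.prod = 0 := by
      have h := congrArg (MvPolynomial.eval p) hu
      rw [MvPolynomial.eval_mul, hp] at h
      obtain ⟨r, hr, hur⟩ := MvPolynomial.isUnit_iff_eq_C_of_isReduced.mp u.isUnit
      rw [hur, MvPolynomial.eval_C] at h
      exact (mul_eq_zero.mp h).resolve_right hr.ne_zero
    rw [map_multiset_prod, Multiset.prod_eq_zero_iff] at hprod
    obtain ⟨G, hG, hG0⟩ := Multiset.mem_map.mp hprod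
    exact ⟨G, hG, hG0⟩
  -- a good rational value of the period: `2ʲ c ∉ S` for `j ≤ m`, `c ≠ 0`
  obtain ⟨c, hc0, hcS⟩ : ∃ c : ℚ, c ≠ 0 ∧ ∀ j : Fin (m + 1), (2 : ℚ) ^ (j : ℕ) * c ∉ S := by
    have hbad : ({(0 : ℚ)} ∪ ⋃ j : Fin (m + 1), (fun t : ℚ => t / 2 ^ (j : ℕ)) '' S).Finite :=
      (Set.finite_singleton 0).union (Set.finite_iUnion fun j => hSfin.image _)
    obtain ⟨c, hc⟩ := hbad.infinite_compl.nonempty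
    simp only [Set.mem_compl_iff, Set.mem_union, Set.mem_singleton_iff, Set.mem_iUnion,
      Set.mem_image, not_or, not_exists, not_and] at hc
    refine ⟨c, hc.1, fun j hj => ?_⟩
    exact hc.2 j _ hj (by field_simp)
  -- the specialised points `b_j` with `b_j + 2ʲc·D ⊆ V(F)`
  have hpts : ∀ j : Fin (m + 1), ∃ b : Fin 2 → algebraicClosure ℚ ℂ, ∀ κ ∈ D,
      MvPolynomial.eval (fun i => b i + ((2 : algebraicClosure ℚ ℂ) ^ (j : ℕ) * (c : algebraicClosure ℚ ℂ)) *
        (κ i : algebraicClosure ℚ ℂ)) FA = 0 := by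
    intro j
    obtain ⟨a, ha2, ha⟩ := hspec ((2 : ℚ) ^ (j : ℕ) * c) (hcS j)
    refine ⟨![a 0, a 1], fun κ hκ => ?_⟩
    set Pκ : MvPolynomial (Fin 3) ℚ := MvPolynomial.aeval
      ![MvPolynomial.X 0 + MvPolynomial.C (κ 0 : ℚ) * MvPolynomial.X 2,
        MvPolynomial.X 1 + MvPolynomial.C (κ 1 : ℚ) * MvPolynomial.X 2] F with hPκ
    have h1 : MvPolynomial.aeval ![x 0, x 1, s] Pκ = 0 := by
      rw [hPκ, MvPolynomial.comp_aeval_apply]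
      have e : (fun i => MvPolynomial.aeval ![x 0, x 1, s]
          ((![MvPolynomial.X 0 + MvPolynomial.C (κ 0 : ℚ) * MvPolynomial.X 2,
            MvPolynomial.X 1 + MvPolynomial.C (κ 1 : ℚ) * MvPolynomial.X 2] :
              Fin 2 → MvPolynomial (Fin 3) ℚ) i)) = fun i => x i + s * (κ i : ℂ) := by
        funext i
        fin_cases i
        · simp; ring
        · simp; ring
      rw [e]
      exact hκ
    have h2 := ha Pκ h1
    rw [hPκ, MvPolynomial.comp_aeval_apply] at h2
    rw [hFA, MvPolynomial.eval_map, ← MvPolynomial.aeval_def]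
    have e : (fun i => (![a 0, a 1] : Fin 2 → algebraicClosure ℚ ℂ) i +
        ((2 : algebraicClosure ℚ ℂ) ^ (j : ℕ) * (c : algebraicClosure ℚ ℂ)) * (κ i : algebraicClosure ℚ ℂ)) =
        fun i => MvPolynomial.aeval a
          ((![MvPolynomial.X 0 + MvPolynomial.C (κ 0 : ℚ) * MvPolynomial.X 2,
            MvPolynomial.X 1 + MvPolynomial.C (κ 1 : ℚ) * MvPolynomial.X 2] :
              Fin 2 → MvPolynomial (Fin 3) ℚ) i) := by
      funext i
      fin_cases i
      · simp [ha2]; ring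
      · simp [ha2]; ring
    rw [e]
    exact h2
  choose b hb using hpts
  -- for each lattice point and each `j`, an irreducible factor vanishing at `b_j + 2ʲc κ`
  have hchoice : ∀ (κ : D) (j : Fin (m + 1)), ∃ G : {G // G ∈ fac.toFinset},
      MvPolynomial.eval (fun i => b j i + ((2 : algebraicClosure ℚ ℂ) ^ (j : ℕ) *
        (c : algebraicClosure ℚ ℂ)) * ((κ : Fin 2 → ℤ) i : algebraicClosure ℚ ℂ)) G.1 = 0 := by
    intro κ j
    obtain ⟨G, hG, hG0⟩ := hfacprop _ (hb j κ κ.2)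
    exact ⟨⟨G, Multiset.mem_toFinset.mpr hG⟩, hG0⟩
  choose ι hι using hchoice
  haveI : Infinite D := Set.infinite_coe_iff.mpr hinf
  obtain ⟨τ, hτ⟩ := Finite.exists_infinite_fiber ι
  -- pigeonhole: two values of the period with the same factor
  have hcard : Fintype.card {G // G ∈ fac.toFinset} < Fintype.card (Fin (m + 1)) := by
    rw [Fintype.card_coe, Fintype.card_fin]
    exact Nat.lt_succ_of_le (by rw [hm]; exact Multiset.toFinset_card_le fac)
  obtain ⟨j₁, j₂, hne, hτeq⟩ := Fintype.exists_ne_map_eq_of_card_lt τ hcard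
  wlog hlt : j₁ < j₂ generalizing j₁ j₂ with H
  · exact H j₂ j₁ hne.symm hτeq.symm (lt_of_le_of_ne (not_lt.mp hlt) (Ne.symm hne))
  set G := ((τ j₁ : {G // G ∈ fac.toFinset}) : MvPolynomial (Fin 2) (algebraicClosure ℚ ℂ)) with hGdef
  have hGfac : G ∈ fac := Multiset.mem_toFinset.mp (τ j₁).2
  have hGirr : Irreducible G := UniqueFactorizationMonoid.irreducible_of_factor G hGfac
  have hGdvd : G ∣ FA := UniqueFactorizationMonoid.dvd_of_mem_factors hGfac
  -- the infinite sub-lattice carried by `G` at both periods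
  set D' : Set (Fin 2 → ℤ) := Subtype.val '' (ι ⁻¹' {τ}) with hD'
  have hD'inf : D'.Infinite := (Set.infinite_coe_iff.mp hτ).image Subtype.val_injective.injOn
  have hD'zero : ∀ κ ∈ D', ∀ j, MvPolynomial.eval (fun i => b j i +
      ((2 : algebraicClosure ℚ ℂ) ^ (j : ℕ) * (c : algebraicClosure ℚ ℂ)) * (κ i : algebraicClosure ℚ ℂ))
        (τ j).1 = 0 := by
    rintro _ ⟨κ, hκ, rfl⟩ j
    have := hι κ j
    rw [Set.mem_preimage, Set.mem_singleton_iff] at hκ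
    rw [hκ] at this
    exact this
  -- the structure lemma: `G` is a rational line
  set e := (j₂ : ℕ) - (j₁ : ℕ) with he
  have hlt' : (j₁ : ℕ) < (j₂ : ℕ) := hlt
  have he0 : 0 < e := Nat.sub_pos_of_lt hlt'
  set l : algebraicClosure ℚ ℂ := (2 : algebraicClosure ℚ ℂ) ^ e with hl
  have hlinj : ∀ m n : ℕ, l ^ m = l ^ n → m = n := by
    intro m' n' h
    rw [hl, ← pow_mul, ← pow_mul] at h
    have h' : (2 : ℕ) ^ (e * m') = 2 ^ (e * n') := by exact_mod_cast h
    have := Nat.pow_right_injective (le_refl 2) h'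
    exact Nat.eq_of_mul_eq_mul_left he0 this
  set cc : algebraicClosure ℚ ℂ := (2 : algebraicClosure ℚ ℂ) ^ (j₁ : ℕ) * (c : algebraicClosure ℚ ℂ)
    with hcc
  have hcc0 : cc ≠ 0 := mul_ne_zero (pow_ne_zero _ two_ne_zero) (by exact_mod_cast hc0)
  have hlcc : l * cc = (2 : algebraicClosure ℚ ℂ) ^ (j₂ : ℕ) * (c : algebraicClosure ℚ ℂ) := by
    rw [hl, hcc, ← mul_assoc, ← pow_add, he, Nat.sub_add_cancel hlt'.le]
  have h1 : ∀ κ ∈ D', MvPolynomial.eval (fun i => b j₁ i + cc * (κ i : algebraicClosure ℚ ℂ)) G = 0 :=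
    fun κ hκ => hD'zero κ hκ j₁
  have h2 : ∀ κ ∈ D', MvPolynomial.eval (fun i => b j₂ i + l * cc * (κ i : algebraicClosure ℚ ℂ)) G = 0 := by
    intro κ hκ
    rw [hlcc, hGdef, hτeq]
    exact hD'zero κ hκ j₂
  obtain ⟨q, κ', u, hq, -, hGeq⟩ := structure_lemma hGirr hcc0 hlinj hD'inf h1 h2
  -- the rational line divides `F` over `ℚ̄`: `q·x` algebraic, against Hermite–Lindemann
  have hLdvd : (MvPolynomial.C (q 0 : algebraicClosure ℚ ℂ) * MvPolynomial.X 0 +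
      MvPolynomial.C (q 1 : algebraicClosure ℚ ℂ) * MvPolynomial.X 1 - MvPolynomial.C κ') ∣ FA :=
    dvd_trans (Dvd.intro_left _ hGeq.symm) hGdvd
  have halgq := isAlgebraic_of_linear_dvd (A := algebraicClosure ℚ ℂ) hF hFx hq hLdvd
  exact not_isAlgebraic_intCombination hx halg q hq halgq

/-! ## The registered stub -/

/-- **Stub 4a — branch finiteness at rank 2.** Only finitely many kernel translates `x + 2πik`,
`k ∈ ℤ²`, of a ℚ-linearly independent pair `x` with `trdeg ℚ(x, eˣ) < 2` are mates of `x`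
(moving sector: `movingSector_finite`; log sector: `logSector_transcendentalPeriod` /
`logSector_algebraicPeriod_finite`). [cite: Lang1966, Ch. II §1] -/
theorem stub_branchFiniteness_rankTwo : ∀ (x : Fin 2 → ℂ), (LinearIndependent ℚ x ∧ Algebra.trdeg ℚ ↥(IntermediateField.adjoin ℚ (Set.range x ∪ Set.range (Complex.exp ∘ x))) < (2 : Cardinal)) → {k : Fin 2 → ℤ | LinearIndependent ℚ (fun i => x i + 2 * ↑Real.pi * Complex.I * (k i : ℂ)) ∧ ∀ p : MvPolynomial (Fin 2 ⊕ Fin 2) ℚ, MvPolynomial.aeval (Sum.elim x (Complex.exp ∘ x)) p = 0 → MvPolynomial.aeval (Sum.elim (fun i => x i + 2 * ↑Real.pi * Complex.I * (k i : ℂ)) (Complex.exp ∘ fun i => x i + 2 * ↑Real.pi * Complex.I * (k i : ℂ))) p = 0}.Finite := by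
  rintro x ⟨hx, htr⟩
  by_cases hM : ∃ i, Transcendental ℚ (cexp (x i))
  · obtain ⟨i, hi⟩ := hM
    exact movingSector_finite x htr i hi
  · -- log sector
    have halg : ∀ i, IsAlgebraic ℚ (cexp (x i)) := fun i =>
      not_not.mp fun h => hM ⟨i, h⟩
    have hxK : ∀ j, x j ∈ IntermediateField.adjoin ℚ (Set.range x ∪ Set.range (cexp ∘ x)) :=
      fun j => IntermediateField.subset_adjoin ℚ _ (Or.inl (Set.mem_range_self j))
    obtain ⟨F₀, hF₀, hF₀x⟩ := exists_mvPolynomial_of_trdeg_lt_two htr (hxK 0) (hxK 1)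
    have ex : (![x 0, x 1] : Fin 2 → ℂ) = x := by ext i; fin_cases i <;> rfl
    rw [ex] at hF₀x
    by_cases hT : Transcendental (Algebra.adjoin ℚ (Set.range x)) (2 * ↑Real.pi * I)
    · refine (Set.finite_singleton (0 : Fin 2 → ℤ)).subset ?_
      rintro k ⟨-, hk⟩
      rw [Set.mem_singleton_iff]
      by_contra hk0
      exact logSector_transcendentalPeriod hx halg hF₀ hT hk0 (transfer_inl hk hF₀x)
    · obtain ⟨F, hFirr, hFx⟩ := exists_irreducible_of_aeval_eq_zero hF₀ hF₀x
      have hT' : IsAlgebraic (Algebra.adjoin ℚ (Set.range x)) (2 * ↑Real.pi * I) := not_not.mp hT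
      refine (logSector_algebraicPeriod_finite x hx halg F hFirr hFx hT').subset ?_
      rintro k ⟨-, hk⟩
      exact transfer_inl hk hFx

end Summit.Schanuel.Schanuel.Cruxes.MinimalCounterexampleInAcl.KernelArithmeticSelection

end
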